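import Literature.NumberTheory.GaloisRepresentations.SuperellipticFrobeniusClassNumber
import Literature.NumberTheory.GaloisRepresentations.PicardGoodReductionDeuring
import Literature.FieldTheory.AlgClosed.PadicAlgClEquivComplex
import HarnessLib

/-!
# Galois representations of Picard curves from "`deg = det`" on the Tate module of the divisor class group

Topic `Literature/NumberTheory/GaloisRepresentations`; **proof file** (theorems only; D-0014/D-0026: no
definitions, no named facts).  Toward `picardCurve_exists_lambdaAdicRep` (Upton 2009: the `(1 - ω)`-adic
representations of `Γ_{ℚ(ω)}` attached to the Picard curves `y³ = f₄(x)`).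

The tree proves the fact from Weil's trace formula `hW` (`picardCurve_exists_lambdaAdicRep_of_weil`), and proves
the divisor-theoretic half of Weil's argument outright: `#{c ∈ Pic(C_{f,Ω}) : deg c = 0, φ^r c = c} = ∏ᵢ (1 - αᵢ^r)`
(`exists_natCard_fixed_degreeZero_eq_prod`, `SuperellipticFrobeniusClassNumber`).  This file reduces the fact to
the other, genuinely geometric half in its most primitive form — **`deg = det` on the `ℓ`-adic Tate module**
(`picardCurve_exists_lambdaAdicRep_of_degdet`, hypothesis `hD`):

> `V_ℓ Pic(C_{f,Ω})` is finite-dimensional over `ℚ_ℓ` and `det(1 - V_ℓ(φ)^r) = #{c : deg c = 0, φ^r c = c}` for all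
> `r ≥ 1` (`φ` the `q`-Frobenius of `Gal(Ω/k)`, `k` finite, `ℓ ≠ char k`),

i.e. Mumford, *Abelian varieties*, §19 Thm. 4 ("`deg φ = det T_ℓ(φ)`", from the theorem of the cube) applied to
`1 - π^r` on the Jacobian, with `ker(1 - π^r) = J(𝔽_{q^r}) = Pic⁰(C_Ω)^{φ^r}` (Milne, *Abelian varieties*, Thm. 19.1,
proof: "`N_m = deg(π^m - 1)`"; Lang, *Abelian Varieties*, VII §1 Thm. 3).  Given `hD`, the numbers
`det(1 - V_ℓ(φ)^r) = ∏ᵢ (1 - αᵢ^r)` determine the eigenvalues of `V_ℓ(φ)` as the `αᵢ`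
(`FrobeniusCharpoly.trace_eq_intCast`, with `|αᵢ| = √q > 1`), so `Tr V_ℓ(φ) = ∑ αᵢ = q + 1 - N₁ = q + 1 - #{Q : φ Q = Q}`
(`natCard_fixedPlaces_frobenius_eq_pointCount_one`) — the hypothesis `hW`.

Doors to the fact now in the tree: `…_of_lefschetz (hX3)`, `…_of_weil (hW)`, `…_of_charpoly (hC)`,
`…_of_degdet (hD)`; none of the four hypotheses is a declaration of the tree (each quotes the printed theorem in
the tree's vocabulary).

## References
* D. Mumford, *Abelian Varieties*, Oxford Univ. Press (1970), §19 Thm. 4, §21. [MumfordAV1970]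
* J. S. Milne, *Abelian varieties* (Thm. 19.1) and *Jacobian varieties* (Thm. 11.1), in: Arithmetic Geometry
  (Cornell–Silverman eds.), Springer (1986). [Milne1986AbelianVarieties] [Milne1986JacobianVarieties]
* S. Lang, *Abelian Varieties*, Springer (1983), VII §1 Thm. 3. [Lang1983AbelianVarieties]
* C. Upton, *Galois representations attached to Picard curves*, J. Algebra 322 (2009). [Upton2009]
-/

noncomputable section

open Polynomial
open scoped Classical

namespace Literature.NumberTheory.GaloisRepresentations

open Literature.NumberTheory.EllipticCurves Literature.NumberTheory.DiophantineGeometry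
  Literature.NumberTheory.DiophantineGeometry.AlgFunctionField Literature.NumberTheory.LFunctions
  SuperellipticFunctionField

/-- **`picardCurve_exists_lambdaAdicRep` from `deg = det` for the Frobenius of superelliptic divisor class groups.**
Hypothesis `hD` — the one remaining geometric input, in its most primitive form (Mumford, *Abelian varieties*,
§19 Thm. 4 "`deg φ = det T_ℓ(φ)`" applied to `φ = 1 - π^r`, with §21 / Lang, *Abelian Varieties*, VII §1 Thm. 3;
Milne, *Abelian varieties*, Thm. 19.1 (proof): "`N_m = deg(π^m - 1) = det(π^m - 1 | T_ℓ A)`"; for the Jacobian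
`J = Pic⁰` of `C_f`, `ker(1 - π^r) = J(𝔽_{q^r}) = Pic⁰(C_Ω)^{φ^r}`): for every finite field `k`, algebraically closed
algebraic `Ω ⊇ k`, primes `p, ℓ` nonzero in `k`, `f ∈ k[X]` separable with `p ∤ deg f` and the `q`-Frobenius `φ` of
`Ω/k`, the `ℚ_ℓ`-space `V_ℓ Pic(C_{f,Ω})` is finite-dimensional and for every `r ≥ 1`
`det(1 - V_ℓ(φ)^r) = #{c ∈ Pic(C_{f,Ω}) : deg c = 0, φ^r c = c}`.
Conclusion: all of `picardCurve_exists_lambdaAdicRep`.  Proof: the divisor-theoretic half of Weil's argument is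
PROVED in the tree — `#{c : deg c = 0, φ^r c = c} = ∏ᵢ (1 - αᵢ^r)` with `αᵢ` the reciprocal roots of `L_{k(C_f)}`,
`|αᵢ| = √q` (`exists_natCard_fixed_degreeZero_eq_prod`, from the zeta function of the pair `(Ω(C_f), φ^r)`, Lang's
theorem, Riemann–Roch over `Ω` and Hasse–Weil) — so `det(1 - V_ℓ(φ)^r) = ∏ᵢ (1 - αᵢ^r)` for all `r`, whence
`Tr V_ℓ(φ) = ∑ αᵢ = q + 1 - N₁` (`FrobeniusCharpoly.trace_eq_intCast`: the eigenvalues of `V_ℓ(φ)` are the `αᵢ`)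
`= q + 1 - #{Q : φ Q = Q}` (`natCard_fixedPlaces_frobenius_eq_pointCount_one`), which is the hypothesis `hW` of
`picardCurve_exists_lambdaAdicRep_of_weil`.
[cite: MumfordAV1970, §19 Thm. 4, §21] [cite: Milne1986AbelianVarieties, Thm. 19.1]
[cite: Milne1986JacobianVarieties, §11 Thm. 11.1] [cite: Upton2009] -/
theorem picardCurve_exists_lambdaAdicRep_of_degdet
    (hD : ∀ (k : Type) [Field k] [Fintype k] (Ω : Type) [Field Ω] [Algebra k Ω] [IsAlgClosed Ω]
      [Algebra.IsAlgebraic k Ω] (p : ℕ) [Fact p.Prime] (ℓ : ℕ) [Fact ℓ.Prime] (f : k[X]),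
      (p : k) ≠ 0 → (ℓ : k) ≠ 0 → f.Separable → ¬ p ∣ f.natDegree →
      ∀ [Fact (Irreducible (superellipticPoly k Ω p f))] (φ : Ω ≃ₐ[k] Ω), (∀ x : Ω, φ x = x ^ Fintype.card k) →
        ∃ _ : Module.Finite ℚ_[ℓ] (RationalTateModule (SuperellipticPic k Ω p f) ℓ),
          ∀ r : ℕ, 0 < r →
            LinearMap.det (1 - rationalTateRepresentation (Ω ≃ₐ[k] Ω) (SuperellipticPic k Ω p f) ℓ φ ^ r) =
              (Nat.card {c : SuperellipticPic k Ω p f //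
                SuperellipticPic.degree k Ω p f c = 0 ∧ (φ ^ r) • c = c} : ℚ_[ℓ])) :
    picardCurve_exists_lambdaAdicRep := by
  refine picardCurve_exists_lambdaAdicRep_of_weil fun k _ _ Ω _ _ _ _ p _ ℓ _ f hpk hℓk hsep hndvd _ φ hφ => ?_
  have hdeg : 0 < f.natDegree := Nat.pos_of_ne_zero fun h => hndvd (by rw [h]; exact dvd_zero p)
  haveI : Fact (Irreducible (superellipticPoly k k p f)) := fact_irreducible_superellipticPoly k k f hsep hdeg
  obtain ⟨hfin, hdet⟩ := hD k Ω p ℓ f hpk hℓk hsep hndvd φ hφ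
  obtain ⟨α, hαn, hαN, hh⟩ := exists_natCard_fixed_degreeZero_eq_prod (Ω := Ω) φ hφ hpk hsep hndvd
  obtain ⟨e⟩ := PadicAlgCl.nonempty_ringEquiv_complex ℓ
  set ρ := rationalTateRepresentation (Ω ≃ₐ[k] Ω) (SuperellipticPic k Ω p f) ℓ with hρ
  -- `V_ℓ(φ)` is invertible
  have hf : LinearMap.det (ρ φ) ≠ 0 := by
    have h : LinearMap.det (ρ φ) * LinearMap.det (ρ φ⁻¹) = 1 := by
      rw [← map_mul, ← map_mul, mul_inv_cancel, map_one, map_one]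
    exact left_ne_zero_of_mul_eq_one h
  have hc : (1 : ℝ) < √(Fintype.card k : ℝ) := by
    rw [show (1 : ℝ) = √1 from Real.sqrt_one.symm]
    exact Real.sqrt_lt_sqrt zero_le_one (by exact_mod_cast Fintype.one_lt_card)
  have ht : (((Fintype.card k : ℤ) + 1 - (pointCount k (SuperellipticFunctionField k k p f) 1 : ℤ) : ℤ) : ℂ) =
      ∑ i, α i := by
    have h1 := hαN 1 Nat.one_pos
    simp only [pow_one] at h1
    push_cast
    linear_combination -h1
  have key := FrobeniusCharpoly.trace_eq_intCast (K := PadicAlgCl ℓ) (e : PadicAlgCl ℓ →+* ℂ) (f := ρ φ)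
    (N := fun r => (Nat.card {c : SuperellipticPic k Ω p f //
      SuperellipticPic.degree k Ω p f c = 0 ∧ (φ ^ r) • c = c} : ℤ))
    hf hc hαn (fun r hr => by rw [hdet r hr]; simp) (fun r hr => by rw [← hh r hr]; simp) ht
  rw [key, ← natCard_fixedPlaces_frobenius_eq_pointCount_one φ hφ hpk hsep hndvd]
  push_cast
  ring

end Literature.NumberTheory.GaloisRepresentations
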